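import Literature.Computability.QuantumComplexity.ADHMachine
import Literature.Computability.QuantumComplexity.OraclePathSums
import Literature.Computability.Complexity.ListFoldBricks
import Literature.Barriers.QuantumAdvantage.AaronsonChenOracle
import HarnessLib

/-!
# The one-gate consistency check of a path tableau through a Clifford+`T` circuit with annotated oracle gates

Support file (`Literature/Barriers/QuantumAdvantage`, next to `AaronsonChenSimulation.lean`). Machine-level support for the `PSPACE^{TQBF}`
simulation in the proof of Aaronson–Chen 2017, Lemma 5.3 (CCC 2017, §5.3, pp. 22–23: "all the
computations can be done in `PSPACE`"), whose `PSPACE` predicates are signs of pair counts of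
computational PATHS through the replaced circuit (`OraclePathSums.lean`: `annPathStep`,
`annSetA`/`annSetB`, `linFormTest`). Such a count is put into `PSPACE` not by running the paths
(an exponential loop) but by VERIFYING a guessed tableau of the two paths — the sequence of their
basis labels and phases, one item per gate — with a polynomially bounded `∀` over the gate index
of a single-gate consistency check (`PSpaceClosure.polyForall_mem_PSPACE`) and summing the
weights of the consistent tableaux (`PSpaceSignedSum.signedSum_pos_mem_PSPACE`). This file is that
single-gate check, as a total `FP` string function with its value on well-formed arguments:

* `acGateCode g tbl` — the code of an annotated gate: a Clifford+`T` gate symbol is coded as the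
  tree's `QGate.encode` (tag `0`); an oracle gate with query wires `e` and FINITE TABLE `tbl`
  (the known part `O ∩ K` of Aaronson–Chen's replacement `TQBF ⊕ (O ∩ K)`) as
  `1 ⟨encList [bin e₀, …, bin e_k], encList tbl⟩`;
* `trustStep g tbl c a w` (`oStep` at oracle gates) — the TRUSTING path step: as `annPathStep`
  for the language `B ⊕ ↑tbl`, except that at a `0`-side query `0p` (answered by the `PSPACE`
  oracle `B`, which a polynomial-time check cannot evaluate) the flip is the GUESS bit `a`;
  elsewhere `a` must be `0`, and the choice bit `c` must be `0` at non-branching gates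
  (`trustStep_eq_annPathStep`: with the correct guess `a = guessOf B g w` — `oGuess` of the query
  — it is `annPathStep`); `stepOut` adds the phase bookkeeping `(φ + ψ) mod 8`;
* `chkArg code c a lab ph lab' ph'` — the argument record `⟨code, ⟨[c,a], ⟨lab, ⟨ph, ⟨lab', ph'⟩⟩⟩⟩⟩`
  (labels as bit lists `List.ofFn`, phases as 3-bit little-endian numerals `bits3`);
* `stepChkT` — **the check**, dispatching on the tag: a Clifford+`T` gate is checked by running
  ONE round of the Adleman–DeMarrais–Huang walk `ADH.roundF` (`ADHMachine.lean`, `roundF_rec`: one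
  round = one total step `ADH.tStep`) on a synthesized walk record and comparing; an oracle gate by
  `oracleChkT` (read the label bits on the wires by a fold over the wire list — `Brick.foldFn`,
  `ListFoldBricks.lean` —, form the query, look the payload up in the table — `Brick.anyFn
  eqPairFn` —, or trust the guess, flip the answer wire); `stepChkT_mem_FP`;
* **`stepChkT_chkArg`** — on a well-formed argument the check returns
  `[stepOut g tbl c a w φ = some (w', φ')]`; `stepOut_guessOf` (correct guesses give the annotated
  path step).

## References

* S. Aaronson, L. Chen, *Complexity-theoretic foundations of quantum supremacy experiments*,
  CCC 2017, §5.3 (pp. 22–23) [AaronsonChen2017].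
* L. M. Adleman, J. DeMarrais, M.-D. A. Huang, *Quantum computability*, SIAM J. Comput. 26 (1997),
  §6, Lemma 6.10 (paths through the circuit, one local step per gate) [AdlemanDeMarraisHuang1997],
  machine form `ADHMachine.lean`.
* S. Arora, B. Barak, *Computational Complexity: A Modern Approach*, CUP 2009, §4.1 (Thm. 4.2 area:
  verifying a computation tableau cell by cell), §1.3 [AroraBarakCC2009].
-/

noncomputable section

namespace Literature.Barriers.QuantumAdvantage

namespace AcTab

open _root_.Computability Polynomial Literature.Computability.Complexity Literature.Computability.Complexity.Brick
  Literature.Computability.Complexity.Plumb Literature.Computability.Cryptography Literature.Computability.QuantumComplexity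
  Literature.Computability.QuantumComplexity.ADH

attribute [-simp] Brick.nthF_zero Brick.sndPow_zero

variable {N : ℕ}

/-! ### Codes of annotated gates -/

/-- The code of the wires of a placed oracle gate: the coded list of the binary wire numbers
`e 0, …, e k` (query wires first, answer wire last). [cite: AroraBarakCC2009, §6.1 (descriptions of circuits)] -/
def wiresCode {k : ℕ} (e : Fin (k + 1) ↪ Fin N) : List Bool :=
  encList (List.ofFn fun i : Fin (k + 1) => encodeNat (e i))

/-- **The code of an annotated gate**: `QGate.encode` for a gate symbol (tag `0`); for an oracle
gate with table `tbl`, `1 ⟨wiresCode e, encList tbl⟩`. [cite: AaronsonChen2017, §5.3 (p. 22: the replaced gate g = the known ones)] -/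
def acGateCode : QGate cliffordT N → List (List Bool) → List Bool
  | .gate op e, _ => QGate.encode (QGate.gate op e : QGate cliffordT N)
  | .oracle _ e, tbl => true :: boolPair (wiresCode e) (encList tbl)

/-! ### The trusting step -/

/-- The label after an oracle gate whose answer wire is flipped iff `f`. [cite: NielsenChuang2010, §6.1.1 Eq. (6.2)] -/
def flipAt {k : ℕ} (e : Fin (k + 1) ↪ Fin N) (w : QReg N) (f : Bool) : QReg N :=
  Function.update w (e (Fin.last k)) (w (e (Fin.last k)) ^^ f)

/-- The flip of the answer wire of an oracle gate with table `tbl`, choice bit `c` and guess bit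
`a`, on the query `q` — or `none` if the bits are inadmissible: `c` must be `0`; on the empty
query nothing flips and `a = 0`; on a `1`-side query `1p` the table decides and `a = 0`; on a
`0`-side query `0p` the flip is the GUESS `a`. [cite: AaronsonChen2017, §5.3 (p. 22)] -/
def oStep (tbl : List (List Bool)) (c a : Bool) : List Bool → Option Bool
  | [] => if c || a then none else some false
  | true :: p => if c || a then none else some (decide (p ∈ tbl))
  | false :: _ => if c then none else some a

/-- **The trusting path step** through an annotated gate with choice bit `c` and guess bit `a`:
a gate symbol steps as `pathStep` and needs `a = 0`; an oracle gate flips its answer wire by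
`oStep`. [cite: AaronsonChen2017, §5.3 (p. 22)] -/
def trustStep : QGate cliffordT N → List (List Bool) → Bool → Bool → QReg N → Option (QReg N × ℕ)
  | .gate op e, _, c, a, w => if a then none else pathStep (QGate.gate op e) c w
  | .oracle _ e, tbl, c, a, w => (oStep tbl c a (queryOf e w)).map fun f => (flipAt e w f, 0)

/-- The correct guess on a query: `[p ∈ B]` on a `0`-side query `0p`, else `0`. [folklore] -/
def oGuess (B : Language Bool) : List Bool → Bool
  | false :: p => B.boolIndicator p
  | _ => false

/-- The correct guess at a gate: `oGuess` of the query of an oracle gate, `0` at a gate symbol. [folklore] -/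
def guessOf (B : Language Bool) : QGate cliffordT N → QReg N → Bool
  | .gate _ _, _ => false
  | .oracle _ e, w => oGuess B (queryOf e w)

/-- A Boolean indicator is the `decide` of membership. [folklore] -/
theorem boolIndicator_eq_decide {α : Type*} (s : Set α) (a : α) [Decidable (a ∈ s)] :
    s.boolIndicator a = decide (a ∈ s) := by
  by_cases h : a ∈ s
  · rw [(s.mem_iff_boolIndicator a).1 h, decide_eq_true h]
  · rw [(s.notMem_iff_boolIndicator a).1 h, decide_eq_false h]

/-- The indicator of the joined oracle on the empty query. [folklore] -/
theorem boolIndicator_oracleJoin_nil (A B : Language Bool) : (oracleJoin A B).boolIndicator [] = false :=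
  ((oracleJoin A B).notMem_iff_boolIndicator _).1 nil_not_mem_oracleJoin

/-- The indicator of the joined oracle on a `1`-side query. [folklore] -/
theorem boolIndicator_oracleJoin_true_cons (A B : Language Bool) (p : List Bool) :
    (oracleJoin A B).boolIndicator (true :: p) = B.boolIndicator p := by
  rcases Bool.eq_false_or_eq_true (B.boolIndicator p) with h | h
  · rw [h]; exact ((oracleJoin A B).mem_iff_boolIndicator _).1
      (true_cons_mem_oracleJoin.2 ((B.mem_iff_boolIndicator p).2 h))
  · rw [h]; exact ((oracleJoin A B).notMem_iff_boolIndicator _).1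
      (fun hm => ((B.notMem_iff_boolIndicator p).2 h) (true_cons_mem_oracleJoin.1 hm))

/-- The indicator of the joined oracle on a `0`-side query. [folklore] -/
theorem boolIndicator_oracleJoin_false_cons (A B : Language Bool) (p : List Bool) :
    (oracleJoin A B).boolIndicator (false :: p) = A.boolIndicator p := by
  rcases Bool.eq_false_or_eq_true (A.boolIndicator p) with h | h
  · rw [h]; exact ((oracleJoin A B).mem_iff_boolIndicator _).1
      (false_cons_mem_oracleJoin.2 ((A.mem_iff_boolIndicator p).2 h))
  · rw [h]; exact ((oracleJoin A B).notMem_iff_boolIndicator _).1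
      (fun hm => ((A.notMem_iff_boolIndicator p).2 h) (false_cons_mem_oracleJoin.1 hm))

/-- **With the correct guess `oStep` answers as the joined oracle `B ⊕ ↑tbl`.** [cite: AaronsonChen2017, §5.3 (p. 22)] -/
theorem oStep_oGuess (B : Language Bool) (tbl : List (List Bool)) (c : Bool) (q : List Bool) :
    oStep tbl c (oGuess B q) q = if c then none else some ((oracleJoin B {p | p ∈ tbl}).boolIndicator q) := by
  rcases q with _ | ⟨_ | _, p⟩
  · cases c <;> simp [oStep, oGuess, boolIndicator_oracleJoin_nil]
  · cases c <;> simp [oStep, oGuess, boolIndicator_oracleJoin_false_cons]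
  · cases c <;> simp [oStep, oGuess, boolIndicator_oracleJoin_true_cons, boolIndicator_eq_decide]

/-- **With the correct guess the trusting step is the path step** of the annotated gate with the
language `B ⊕ ↑tbl`. [cite: AaronsonChen2017, §5.3 (p. 22)] -/
theorem trustStep_eq_annPathStep (B : Language Bool) (g : QGate cliffordT N) (tbl : List (List Bool))
    (c : Bool) (w : QReg N) :
    trustStep g tbl c (guessOf B g w) w = annPathStep (g, oracleJoin B {p | p ∈ tbl}) c w := by
  cases g with
  | gate op e => rfl
  | oracle k e =>
    simp only [trustStep, guessOf, oStep_oGuess, annPathStep]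
    cases c <;> rfl

/-- The trusting step with the phase bookkeeping: new label and new phase `(φ + ψ) mod 8`. [folklore] -/
def stepOut (g : QGate cliffordT N) (tbl : List (List Bool)) (c a : Bool) (w : QReg N) (φ : ℕ) :
    Option (QReg N × ℕ) :=
  (trustStep g tbl c a w).map fun r => (r.1, (φ + r.2) % 8)

/-! ### Three-bit phases -/

/-- The 3-bit little-endian numeral of a phase `φ < 8`. [folklore] -/
def bits3 (φ : ℕ) : List Bool := [decide (φ % 2 = 1), decide (φ / 2 % 2 = 1), decide (φ / 4 % 2 = 1)]

/-- `|bits3 φ| = 3`. [folklore] -/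
@[simp] theorem length_bits3 (φ : ℕ) : (bits3 φ).length = 3 := rfl

/-- `⟦bits3 φ⟧ = φ` for `φ < 8`. [folklore] -/
theorem bitsToNat_bits3 {φ : ℕ} (hφ : φ < 8) : bitsToNat (bits3 φ) = φ := by
  unfold bits3
  interval_cases φ <;> decide

/-- `bits3` is injective below `8`. [folklore] -/
theorem bits3_injective {φ ψ : ℕ} (hφ : φ < 8) (hψ : ψ < 8) (h : bits3 φ = bits3 ψ) : φ = ψ := by
  rw [← bitsToNat_bits3 hφ, ← bitsToNat_bits3 hψ, h]

/-- The unary numeral of a 3-bit phase read with a ruler of length `7`. [folklore] -/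
theorem binToUnaryFn_bits3 {φ : ℕ} (hφ : φ < 8) : binToUnaryFn (boolPair (ones 7) (bits3 φ)) = ones φ := by
  rw [binToUnaryFn_boolPair, bitsToNat_bits3 hφ, length_ones, min_eq_left (by omega)]

/-! ### The argument record and its fields -/

/-- The argument record of the check: `⟨code, ⟨[c, a], ⟨lab, ⟨ph, ⟨lab', ph'⟩⟩⟩⟩⟩`. [folklore] -/
def chkArg (code : List Bool) (c a : Bool) (lab ph lab' ph' : List Bool) : List Bool :=
  boolPair code (boolPair [c, a] (boolPair lab (boolPair ph (boolPair lab' ph'))))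

/-- Field: the gate code. [folklore] -/
def gcF : List Bool → List Bool := nthF 0
/-- Field: the two bits `[c, a]`. [folklore] -/
def cwF : List Bool → List Bool := nthF 1
/-- Field: the label before the gate. [folklore] -/
def labF : List Bool → List Bool := nthF 2
/-- Field: the 3-bit phase before the gate. [folklore] -/
def phbF : List Bool → List Bool := nthF 3
/-- Field: the claimed label after the gate. [folklore] -/
def lab'F : List Bool → List Bool := nthF 4
/-- Field: the claimed 3-bit phase after the gate. [folklore] -/
def ph'F : List Bool → List Bool := sndPow 4
/-- The choice bit `c`, as a one-bit condition. [folklore] -/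
def cT : List Bool → List Bool := bitT cwF
/-- The guess bit `a`, as a one-bit condition. [folklore] -/
def aT : List Bool → List Bool := bitT (List.tail ∘ cwF)

section Fields

variable (code : List Bool) (c a : Bool) (lab ph lab' ph' : List Bool)

/-- `gcF` on an argument. [folklore] -/
@[simp] theorem gcF_chkArg : gcF (chkArg code c a lab ph lab' ph') = code := by simp [gcF, chkArg]
/-- `cwF` on an argument. [folklore] -/
@[simp] theorem cwF_chkArg : cwF (chkArg code c a lab ph lab' ph') = [c, a] := by simp [cwF, chkArg]
/-- `labF` on an argument. [folklore] -/
@[simp] theorem labF_chkArg : labF (chkArg code c a lab ph lab' ph') = lab := by simp [labF, chkArg]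
/-- `phbF` on an argument. [folklore] -/
@[simp] theorem phbF_chkArg : phbF (chkArg code c a lab ph lab' ph') = ph := by simp [phbF, chkArg]
/-- `lab'F` on an argument. [folklore] -/
@[simp] theorem lab'F_chkArg : lab'F (chkArg code c a lab ph lab' ph') = lab' := by simp [lab'F, chkArg]
/-- `ph'F` on an argument. [folklore] -/
@[simp] theorem ph'F_chkArg : ph'F (chkArg code c a lab ph lab' ph') = ph' := by simp [ph'F, chkArg]
/-- `cT` on an argument. [folklore] -/
@[simp] theorem cT_chkArg : cT (chkArg code c a lab ph lab' ph') = [c] := by simp [cT]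
/-- `aT` on an argument. [folklore] -/
@[simp] theorem aT_chkArg : aT (chkArg code c a lab ph lab' ph') = [a] := by simp [aT]

end Fields

/-- The field functions are in `FP`. [folklore] -/
theorem gcF_mem_FP : gcF ∈ FP := nthF_mem_FP 0
/-- `cwF ∈ FP`. [folklore] -/
theorem cwF_mem_FP : cwF ∈ FP := nthF_mem_FP 1
/-- `labF ∈ FP`. [folklore] -/
theorem labF_mem_FP : labF ∈ FP := nthF_mem_FP 2
/-- `phbF ∈ FP`. [folklore] -/
theorem phbF_mem_FP : phbF ∈ FP := nthF_mem_FP 3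
/-- `lab'F ∈ FP`. [folklore] -/
theorem lab'F_mem_FP : lab'F ∈ FP := nthF_mem_FP 4
/-- `ph'F ∈ FP`. [folklore] -/
theorem ph'F_mem_FP : ph'F ∈ FP := sndPow_mem_FP 4
/-- `cT ∈ FP`. [folklore] -/
theorem cT_mem_FP : cT ∈ FP := bitT_mem_FP cwF_mem_FP
/-- `aT ∈ FP`. [folklore] -/
theorem aT_mem_FP : aT ∈ FP := bitT_mem_FP (comp_mem_FP PRelSigma.tail_mem_FP cwF_mem_FP)

/-! ### Reading label bits on a list of wires (a fold over the wire list) -/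

/-- The fold step collecting label bits: `⟨⟨lab, wl⟩, ⟨a, acc⟩⟩ ↦ acc ++ [lab at ⟦a⟧]`. [folklore] -/
def bitsStep : List Bool → List Bool := fun v =>
  (sndF ∘ sndF) v ++ (bitAtFn ∘ fanoutFn (binToUnaryFn ∘ fanoutFn (fstF ∘ fstF) (fstF ∘ sndF)) (fstF ∘ fstF)) v

/-- `bitsStep ∈ FP`. [folklore] -/
theorem bitsStep_mem_FP : bitsStep ∈ FP :=
  append_mem_FP (comp_mem_FP sndF_mem_FP sndF_mem_FP)
    (comp_mem_FP bitAtFn_mem_FP (fanoutFn_mem_FP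
      (comp_mem_FP binToUnaryFn_mem_FP (fanoutFn_mem_FP (comp_mem_FP fstF_mem_FP fstF_mem_FP) (comp_mem_FP fstF_mem_FP sndF_mem_FP)))
      (comp_mem_FP fstF_mem_FP fstF_mem_FP)))

/-- `bitsStep` grows the accumulator by at most one symbol. [folklore] -/
theorem foldGrowth_bitsStep : FoldGrowth 1 bitsStep := by
  intro v
  have h : (bitAtFn (boolPair (binToUnaryFn (boolPair (fstF (fstF v)) (fstF (sndF v)))) (fstF (fstF v)))).length ≤ 1 := by
    rw [bitAtFn_boolPair, List.length_take]; exact min_le_left _ _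
  simp only [bitsStep, Function.comp_apply, fanoutFn_apply, List.length_append]
  omega

/-- **The label bits on the wires**: `⟨lab, wl⟩ ↦` the string of the bits of `lab` at the positions
listed (in binary) in `wl`. [folklore] -/
def wireBitsFn : List Bool → List Bool := foldFn bitsStep fun _ => []

/-- `wireBitsFn ∈ FP`. [folklore] -/
theorem wireBitsFn_mem_FP : wireBitsFn ∈ FP := foldFn_mem_FP bitsStep_mem_FP (const_mem_FP _) foldGrowth_bitsStep

/-- A left fold that appends one item per element is a map. [folklore] -/
theorem foldl_append_singleton {α β : Type*} (f : α → β) (l : List α) (acc : List β) :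
    l.foldl (fun acc a => acc ++ [f a]) acc = acc ++ l.map f := by
  induction l generalizing acc with
  | nil => simp
  | cons a l ih => rw [List.foldl_cons, ih, List.map_cons, List.append_assoc]; rfl

/-- One fold step on a genuine wire numeral: append the label bit on that wire. [folklore] -/
theorem bitsStep_label (L acc : List Bool) (w : QReg N) (j : Fin N) :
    bitsStep (boolPair (boolPair (List.ofFn w) L) (boolPair (encodeNat j) acc)) = acc ++ [w j] := by
  simp only [bitsStep, Function.comp_apply, fanoutFn_apply, fstF_boolPair, sndF_boolPair, binToUnaryFn_label,
    bitAtFn_label]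

/-- The fold over a list of wire numerals appends the label bits on those wires. [folklore] -/
theorem foldl_bitsStep (L : List Bool) (w : QReg N) : ∀ (ws : List (Fin N)) (acc : List Bool),
    (ws.map fun j : Fin N => encodeNat (j : ℕ)).foldl
        (fun acc a => bitsStep (boolPair (boolPair (List.ofFn w) L) (boolPair a acc))) acc =
      acc ++ ws.map fun j : Fin N => w j
  | [], acc => by simp
  | j :: ws, acc => by
    rw [List.map_cons, List.foldl_cons, bitsStep_label, foldl_bitsStep L w ws, List.map_cons, List.append_assoc]
    rfl

/-- **Value of `wireBitsFn` on a label and the wire code of a placed oracle gate**: the bits of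
the label on the wires `e 0, …, e k`, in order. [folklore] -/
theorem wireBitsFn_label {k : ℕ} (e : Fin (k + 1) ↪ Fin N) (w : QReg N) :
    wireBitsFn (boolPair (List.ofFn w) (wiresCode e)) = List.ofFn fun i : Fin (k + 1) => w (e i) := by
  have hl : (List.ofFn fun i : Fin (k + 1) => encodeNat (e i)) = (List.ofFn e).map fun j : Fin N => encodeNat (j : ℕ) := by
    rw [List.map_ofFn]; rfl
  rw [wireBitsFn, foldFn_boolPair, wiresCode, decNil_encList, hl, foldl_bitsStep, List.nil_append, List.map_ofFn]
  rfl

/-- The fold step keeping the current item: `⟨_, ⟨a, _⟩⟩ ↦ a`. [folklore] -/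
def lastStep : List Bool → List Bool := fstF ∘ sndF

/-- `lastStep ∈ FP`. [folklore] -/
theorem lastStep_mem_FP : lastStep ∈ FP := comp_mem_FP fstF_mem_FP sndF_mem_FP

/-- `lastStep` has growth `0`. [folklore] -/
theorem foldGrowth_lastStep : FoldGrowth 0 lastStep := by
  intro v; simp only [lastStep, Function.comp_apply]; omega

/-- **The last wire numeral**: `⟨lab, wl⟩ ↦` the last item of the coded list `wl` (the answer wire,
in binary). [folklore] -/
def lastWireFn : List Bool → List Bool := foldFn lastStep fun _ => []

/-- `lastWireFn ∈ FP`. [folklore] -/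
theorem lastWireFn_mem_FP : lastWireFn ∈ FP := foldFn_mem_FP lastStep_mem_FP (const_mem_FP _) foldGrowth_lastStep

/-- **Value of `lastWireFn`**: the binary numeral of the answer wire `e k`. [folklore] -/
theorem lastWireFn_label {k : ℕ} (e : Fin (k + 1) ↪ Fin N) (lab : List Bool) :
    lastWireFn (boolPair lab (wiresCode e)) = encodeNat (e (Fin.last k)) := by
  rw [lastWireFn, foldFn_boolPair, wiresCode, decNil_encList]
  have h : (List.ofFn fun i : Fin (k + 1) => encodeNat (e i)).foldl
      (fun acc a => lastStep (boolPair (boolPair lab (encList (List.ofFn fun i : Fin (k + 1) => encodeNat (e i))))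
        (boolPair a acc))) [] =
      (List.ofFn fun i : Fin (k + 1) => encodeNat (e i)).foldl (fun _ a => a) [] := by
    congr 1
    funext acc a
    simp [lastStep]
  rw [h, List.ofFn_succ', List.concat_eq_append, List.foldl_append, List.foldl_cons, List.foldl_nil]

/-! ### The oracle-gate check -/

/-- The oracle part of the code: `⟨wiresCode, encList tbl⟩` (the code without its tag). [folklore] -/
def otF : List Bool → List Bool := List.tail ∘ gcF
/-- The wire code. [folklore] -/
def wlF : List Bool → List Bool := fstF ∘ otF
/-- The table code. [folklore] -/
def tblF : List Bool → List Bool := sndF ∘ otF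
/-- The label bits on all wires of the gate (query wires, then the answer wire). [folklore] -/
def wbitsF : List Bool → List Bool := wireBitsFn ∘ fanoutFn labF wlF
/-- The query string: all wire bits but the last. [folklore] -/
def qF : List Bool → List Bool := takeFn ∘ fanoutFn (List.tail ∘ wbitsF) wbitsF
/-- The current answer bit, as a one-bit string. [folklore] -/
def ansT : List Bool → List Bool := bitAtFn ∘ fanoutFn (List.tail ∘ wbitsF) wbitsF
/-- Is the query empty? [folklore] -/
def nilT : List Bool → List Bool := isNilFn ∘ qF
/-- The side of the query, with the empty query counted as `1`-side (no guess allowed). [folklore] -/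
def sideT : List Bool → List Bool := iteFn nilT (fun _ => [true]) (take1Fn ∘ qF)
/-- The payload of the query (the query without its side bit). [folklore] -/
def payF : List Bool → List Bool := List.tail ∘ qF
/-- Is the payload in the table? [folklore] -/
def memT : List Bool → List Bool := anyFn eqPairFn ∘ fanoutFn payF tblF
/-- The flip of the answer wire: the table on the `1`-side (nothing on the empty query), the guess
on the `0`-side. [cite: AaronsonChen2017, §5.3 (p. 22)] -/
def flipT : List Bool → List Bool := iteFn sideT (iteFn nilT (fun _ => [false]) memT) aT
/-- The admissibility of the two bits: `c = 0`, and `a = 0` unless the query is `0`-side. [folklore] -/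
def okT : List Bool → List Bool := andFn (notFn cT) (orFn (notFn aT) (notFn sideT))
/-- The answer wire in unary. [folklore] -/
def posF : List Bool → List Bool := binToUnaryFn ∘ fanoutFn labF (lastWireFn ∘ fanoutFn labF wlF)
/-- The new answer bit. [folklore] -/
def newBitT : List Bool → List Bool := xorT ansT flipT
/-- The label after the oracle gate: the answer wire rewritten. [cite: NielsenChuang2010, §6.1.1 Eq. (6.2)] -/
def labNewF : List Bool → List Bool :=
  OracleCompose.concatFn ∘ fanoutFn (takeFn ∘ fanoutFn posF labF)
    (OracleCompose.concatFn ∘ fanoutFn newBitT (dropFn ∘ fanoutFn (List.cons true ∘ posF) labF))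
/-- **The oracle-gate check**: admissible bits, claimed label = computed label, phase unchanged.
[cite: AaronsonChen2017, §5.3 (p. 22)] -/
def oracleChkT : List Bool → List Bool :=
  andFn okT (andFn (eqPairFn ∘ fanoutFn labNewF lab'F) (eqPairFn ∘ fanoutFn phbF ph'F))

/-- `eqPairFn` is one bit (twin of `QuantumComplexity.oneBit_eqPairFn` of `FactoringNP.lean`, not
imported here). [folklore] -/
theorem oneBit_eqPairFn' : OneBit eqPairFn := fun z =>
  (eqPairFn_eq_or z).elim (fun h => ⟨_, h⟩) fun h => ⟨_, h⟩

/-- The oracle field functions are in `FP` (compositions of bricks). [folklore] -/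
theorem otF_mem_FP : otF ∈ FP := comp_mem_FP PRelSigma.tail_mem_FP gcF_mem_FP
/-- `wlF ∈ FP`. [folklore] -/
theorem wlF_mem_FP : wlF ∈ FP := comp_mem_FP fstF_mem_FP otF_mem_FP
/-- `tblF ∈ FP`. [folklore] -/
theorem tblF_mem_FP : tblF ∈ FP := comp_mem_FP sndF_mem_FP otF_mem_FP
/-- `wbitsF ∈ FP`. [folklore] -/
theorem wbitsF_mem_FP : wbitsF ∈ FP := comp_mem_FP wireBitsFn_mem_FP (fanoutFn_mem_FP labF_mem_FP wlF_mem_FP)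
/-- `qF ∈ FP`. [folklore] -/
theorem qF_mem_FP : qF ∈ FP :=
  comp_mem_FP takeFn_mem_FP (fanoutFn_mem_FP (comp_mem_FP PRelSigma.tail_mem_FP wbitsF_mem_FP) wbitsF_mem_FP)
/-- `ansT ∈ FP`. [folklore] -/
theorem ansT_mem_FP : ansT ∈ FP :=
  comp_mem_FP bitAtFn_mem_FP (fanoutFn_mem_FP (comp_mem_FP PRelSigma.tail_mem_FP wbitsF_mem_FP) wbitsF_mem_FP)
/-- `nilT ∈ FP`. [folklore] -/
theorem nilT_mem_FP : nilT ∈ FP := comp_mem_FP isNilFn_mem_FP qF_mem_FP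
/-- `sideT ∈ FP`. [folklore] -/
theorem sideT_mem_FP : sideT ∈ FP := iteFn_mem_FP nilT_mem_FP (const_mem_FP _) (comp_mem_FP take1Fn_mem_FP qF_mem_FP)
/-- `payF ∈ FP`. [folklore] -/
theorem payF_mem_FP : payF ∈ FP := comp_mem_FP PRelSigma.tail_mem_FP qF_mem_FP
/-- `memT ∈ FP`. [folklore] -/
theorem memT_mem_FP : memT ∈ FP :=
  comp_mem_FP (anyFn_mem_FP eqPairFn_mem_FP oneBit_eqPairFn') (fanoutFn_mem_FP payF_mem_FP tblF_mem_FP)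
/-- `flipT ∈ FP`. [folklore] -/
theorem flipT_mem_FP : flipT ∈ FP :=
  iteFn_mem_FP sideT_mem_FP (iteFn_mem_FP nilT_mem_FP (const_mem_FP _) memT_mem_FP) aT_mem_FP
/-- `okT ∈ FP`. [folklore] -/
theorem okT_mem_FP : okT ∈ FP :=
  andFn_mem_FP (notFn_mem_FP cT_mem_FP) (orFn_mem_FP (notFn_mem_FP aT_mem_FP) (notFn_mem_FP sideT_mem_FP))
/-- `posF ∈ FP`. [folklore] -/
theorem posF_mem_FP : posF ∈ FP :=
  comp_mem_FP binToUnaryFn_mem_FP (fanoutFn_mem_FP labF_mem_FP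
    (comp_mem_FP lastWireFn_mem_FP (fanoutFn_mem_FP labF_mem_FP wlF_mem_FP)))
/-- `newBitT ∈ FP`. [folklore] -/
theorem newBitT_mem_FP : newBitT ∈ FP := xorT_mem_FP ansT_mem_FP flipT_mem_FP
/-- `labNewF ∈ FP`. [folklore] -/
theorem labNewF_mem_FP : labNewF ∈ FP :=
  comp_mem_FP OracleCompose.concatFn_mem_FP (fanoutFn_mem_FP
    (comp_mem_FP takeFn_mem_FP (fanoutFn_mem_FP posF_mem_FP labF_mem_FP))
    (comp_mem_FP OracleCompose.concatFn_mem_FP (fanoutFn_mem_FP newBitT_mem_FP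
      (comp_mem_FP dropFn_mem_FP (fanoutFn_mem_FP (comp_mem_FP (cons_mem_FP true) posF_mem_FP) labF_mem_FP)))))
/-- `oracleChkT ∈ FP`. [folklore] -/
theorem oracleChkT_mem_FP : oracleChkT ∈ FP :=
  andFn_mem_FP okT_mem_FP (andFn_mem_FP (comp_mem_FP eqPairFn_mem_FP (fanoutFn_mem_FP labNewF_mem_FP lab'F_mem_FP))
    (comp_mem_FP eqPairFn_mem_FP (fanoutFn_mem_FP phbF_mem_FP ph'F_mem_FP)))

/-! ### The Clifford+`T` check: one round of the ADH walk -/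

/-- The synthesized walk record `rec6 ε ⟨code, ε⟩ [c] lab 1^{⟦ph⟧} [1]`. [cite: AdlemanDeMarraisHuang1997, §6 Lemma 6.10 (proof, step 3)] -/
def recF : List Bool → List Bool :=
  mk6 (fun _ => []) (fanoutFn gcF fun _ => []) (take1Fn ∘ cwF) labF
    (binToUnaryFn ∘ fanoutFn (fun _ => ones 7) phbF) fun _ => [true]
/-- One round of the walk on the synthesized record. [cite: AdlemanDeMarraisHuang1997, §6 Lemma 6.10 (proof, step 3)] -/
def rrF : List Bool → List Bool := roundF ∘ recF
/-- **The Clifford+`T` check**: `a = 0`, the round is valid, and it produces the claimed label and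
phase. [cite: AdlemanDeMarraisHuang1997, §6 Lemma 6.10 (proof, step 3)] -/
def cliffChkT : List Bool → List Bool :=
  andFn (notFn aT) (andFn (vT ∘ rrF) (andFn (eqPairFn ∘ fanoutFn (wF ∘ rrF) lab'F)
    (eqPairFn ∘ fanoutFn (phF ∘ rrF) (binToUnaryFn ∘ fanoutFn (fun _ => ones 7) ph'F))))

/-- `recF ∈ FP`. [folklore] -/
theorem recF_mem_FP : recF ∈ FP :=
  mk6_mem_FP (const_mem_FP _) (fanoutFn_mem_FP gcF_mem_FP (const_mem_FP _)) (comp_mem_FP take1Fn_mem_FP cwF_mem_FP)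
    labF_mem_FP (comp_mem_FP binToUnaryFn_mem_FP (fanoutFn_mem_FP (const_mem_FP _) phbF_mem_FP)) (const_mem_FP _)
/-- `rrF ∈ FP`. [folklore] -/
theorem rrF_mem_FP : rrF ∈ FP := comp_mem_FP roundF_mem_FP recF_mem_FP
/-- `cliffChkT ∈ FP`. [folklore] -/
theorem cliffChkT_mem_FP : cliffChkT ∈ FP :=
  andFn_mem_FP (notFn_mem_FP aT_mem_FP) (andFn_mem_FP (comp_mem_FP vT_mem_FP rrF_mem_FP)
    (andFn_mem_FP (comp_mem_FP eqPairFn_mem_FP (fanoutFn_mem_FP (comp_mem_FP (nthF_mem_FP 3) rrF_mem_FP) lab'F_mem_FP))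
      (comp_mem_FP eqPairFn_mem_FP (fanoutFn_mem_FP (comp_mem_FP (nthF_mem_FP 4) rrF_mem_FP)
        (comp_mem_FP binToUnaryFn_mem_FP (fanoutFn_mem_FP (const_mem_FP _) ph'F_mem_FP))))))

/-! ### The dispatch -/

/-- **The one-gate consistency check**: oracle gates (tag `1`) by `oracleChkT`, gate symbols by
`cliffChkT`. [cite: AaronsonChen2017, §5.3 (pp. 22–23)] -/
def stepChkT : List Bool → List Bool := iteFn (take1Fn ∘ gcF) oracleChkT cliffChkT

/-- **`stepChkT ∈ FP`.** [cite: AroraBarakCC2009, §1.3] -/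
theorem stepChkT_mem_FP : stepChkT ∈ FP :=
  iteFn_mem_FP (comp_mem_FP take1Fn_mem_FP gcF_mem_FP) oracleChkT_mem_FP cliffChkT_mem_FP

/-! ### Value of the Clifford+`T` check -/

section CliffordValue

variable (op : CliffordTOp) (e : Fin (cliffordT.arity op) ↪ Fin N) (tbl : List (List Bool)) (c a : Bool)
  (w w' : QReg N) {φ φ' : ℕ}

/-- The synthesized record of a gate-symbol argument. [folklore] -/
theorem recF_chkArg (hφ : φ < 8) :
    recF (chkArg (acGateCode (QGate.gate op e) tbl) c a (List.ofFn w) (bits3 φ) (List.ofFn w') (bits3 φ')) =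
      rec6 [] (encList [(QGate.gate op e : QGate cliffordT N).encode]) [c] (List.ofFn w) (ones φ) [true] := by
  rw [recF, mk6_apply]
  simp only [fanoutFn_apply, gcF_chkArg, Function.comp_apply, cwF_chkArg, labF_chkArg, phbF_chkArg,
    binToUnaryFn_bits3 hφ]
  rfl

/-- One round on it: one total step. [cite: AdlemanDeMarraisHuang1997, §6 Lemma 6.10 (proof, step 3)] -/
theorem rrF_chkArg (hφ : φ < 8) :
    rrF (chkArg (acGateCode (QGate.gate op e) tbl) c a (List.ofFn w) (bits3 φ) (List.ofFn w') (bits3 φ')) =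
      rec6 [] [] [] (List.ofFn (tStep (QGate.gate op e) c (w, φ, true)).1)
        (ones (tStep (QGate.gate op e) c (w, φ, true)).2.1) [(tStep (QGate.gate op e) c (w, φ, true)).2.2] := by
  rw [rrF, Function.comp_apply, recF_chkArg op e tbl c a w w' hφ,
    roundF_rec [] [] [c] w (QGate.gate op e) trivial φ true]
  simp

/-- **Value of the Clifford+`T` check.** [cite: AdlemanDeMarraisHuang1997, §6 Lemma 6.10 (proof, step 3)] -/
theorem cliffChkT_chkArg (hφ : φ < 8) (hφ' : φ' < 8) :
    cliffChkT (chkArg (acGateCode (QGate.gate op e) tbl) c a (List.ofFn w) (bits3 φ) (List.ofFn w') (bits3 φ')) =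
      [decide (stepOut (QGate.gate op e) tbl c a w φ = some (w', φ'))] := by
  set z := chkArg (acGateCode (QGate.gate op e) tbl) c a (List.ofFn w) (bits3 φ) (List.ofFn w') (bits3 φ') with hz
  have hrr := rrF_chkArg op e tbl c a w w' (φ' := φ') hφ
  rw [← hz] at hrr
  set s₂ := tStep (QGate.gate op e) c (w, φ, true) with hs₂
  have haT : aT z = [a] := by rw [hz]; exact aT_chkArg _ _ _ _ _ _ _
  obtain ⟨-, -, -, h3, h4, h5⟩ := fields_rec6 ([] : List Bool) (ones s₂.2.1) [s₂.2.2] [] [] (List.ofFn s₂.1)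
  have hv : (vT ∘ rrF) z = [s₂.2.2] := by
    rw [Function.comp_apply, hrr, vT_apply, h5]
    cases s₂.2.2 <;> rfl
  have hw : (eqPairFn ∘ fanoutFn (wF ∘ rrF) lab'F) z = [decide (List.ofFn s₂.1 = List.ofFn w')] := by
    rw [Function.comp_apply, fanoutFn_apply, eqPairFn_boolPair, Function.comp_apply, hrr, h3, hz, lab'F_chkArg]
  have hp : (eqPairFn ∘ fanoutFn (phF ∘ rrF) (binToUnaryFn ∘ fanoutFn (fun _ => ones 7) ph'F)) z =
      [decide (ones s₂.2.1 = ones φ')] := by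
    rw [Function.comp_apply, fanoutFn_apply, eqPairFn_boolPair, Function.comp_apply, hrr, Function.comp_apply,
      fanoutFn_apply, h4, hz, ph'F_chkArg, binToUnaryFn_bits3 hφ']
  rw [cliffChkT, andFn_apply (notFn_apply haT) (andFn_apply hv (andFn_apply hw hp))]
  congr 1
  rw [Bool.eq_iff_iff]
  simp only [Bool.and_eq_true, Bool.not_eq_true', decide_eq_true_eq, List.ofFn_inj, ones_inj, stepOut, trustStep]
  rw [hs₂, tStep_true]
  cases a
  · rcases hps : pathStep (QGate.gate op e) c w with _ | ⟨w₂, ψ⟩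
    · simp
    · simp only [Option.map_some, Option.some.injEq, Prod.mk.injEq, Bool.false_eq_true, if_false, true_and]
  · simp

end CliffordValue

/-! ### Value of the oracle check -/

section OracleValue

variable {k : ℕ} (e : Fin (k + 1) ↪ Fin N) (tbl : List (List Bool)) (c a : Bool) (w w' : QReg N) (ph ph' : List Bool)

/-- The query wires then the answer wire. [folklore] -/
theorem ofFn_wires_eq : (List.ofFn fun i : Fin (k + 1) => w (e i)) = queryOf e w ++ [w (e (Fin.last k))] := by
  rw [List.ofFn_succ', List.concat_eq_append]
  rfl

/-- The fields of an oracle-gate argument. [folklore] -/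
theorem oracle_fields :
    let z := chkArg (acGateCode (QGate.oracle k e) tbl) c a (List.ofFn w) ph (List.ofFn w') ph'
    wlF z = wiresCode e ∧ tblF z = encList tbl ∧ wbitsF z = queryOf e w ++ [w (e (Fin.last k))] ∧
      qF z = queryOf e w ∧ ansT z = [w (e (Fin.last k))] ∧ posF z = ones (e (Fin.last k)) := by
  intro z
  have hgc : gcF z = true :: boolPair (wiresCode e) (encList tbl) := gcF_chkArg _ _ _ _ _ _ _
  have hwl : wlF z = wiresCode e := by
    rw [wlF, Function.comp_apply, otF, Function.comp_apply, hgc, List.tail_cons, fstF_boolPair]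
  have htbl : tblF z = encList tbl := by
    rw [tblF, Function.comp_apply, otF, Function.comp_apply, hgc, List.tail_cons, sndF_boolPair]
  have hlab : labF z = List.ofFn w := labF_chkArg _ _ _ _ _ _ _
  have hwb : wbitsF z = queryOf e w ++ [w (e (Fin.last k))] := by
    rw [wbitsF, Function.comp_apply, fanoutFn_apply, hlab, hwl, wireBitsFn_label, ofFn_wires_eq]
  have hlen : (queryOf e w).length = k := by simp [queryOf]
  have hq : qF z = queryOf e w := by
    rw [qF, Function.comp_apply, fanoutFn_apply, Function.comp_apply, hwb, takeFn_boolPair]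
    simp
  have hans : ansT z = [w (e (Fin.last k))] := by
    rw [ansT, Function.comp_apply, fanoutFn_apply, Function.comp_apply, hwb, bitAtFn_boolPair]
    simp
  have hpos : posF z = ones (e (Fin.last k)) := by
    rw [posF, Function.comp_apply, fanoutFn_apply, hlab, Function.comp_apply, fanoutFn_apply, hlab, hwl,
      lastWireFn_label, binToUnaryFn_label]
  exact ⟨hwl, htbl, hwb, hq, hans, hpos⟩

/-- The side bit computed by the check (the empty query counts as `1`-side). [folklore] -/
def oside : List Bool → Bool
  | [] => true
  | b :: _ => b

/-- The flip computed by the check. [folklore] -/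
def oflip : List Bool → Bool
  | [] => false
  | true :: p => decide (p ∈ tbl)
  | false :: _ => a

/-- **Value of the oracle check** (raw form). [cite: AaronsonChen2017, §5.3 (p. 22)] -/
theorem oracleChkT_chkArg :
    oracleChkT (chkArg (acGateCode (QGate.oracle k e) tbl) c a (List.ofFn w) ph (List.ofFn w') ph') =
      [(!c && (!a || !oside (queryOf e w))) &&
        (decide (List.ofFn (flipAt e w (oflip tbl a (queryOf e w))) = List.ofFn w') && decide (ph = ph'))] := by
  set z := chkArg (acGateCode (QGate.oracle k e) tbl) c a (List.ofFn w) ph (List.ofFn w') ph' with hz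
  obtain ⟨hwl, htbl, hwb, hq, hans, hpos⟩ := oracle_fields e tbl c a w w' ph ph'
  rw [← hz] at hwl htbl hwb hq hans hpos
  have hcT : cT z = [c] := by rw [hz]; exact cT_chkArg _ _ _ _ _ _ _
  have haT : aT z = [a] := by rw [hz]; exact aT_chkArg _ _ _ _ _ _ _
  have hlab : labF z = List.ofFn w := by rw [hz]; exact labF_chkArg _ _ _ _ _ _ _
  have hnil : nilT z = [decide (queryOf e w = [])] := by rw [nilT, Function.comp_apply, hq]; rfl
  have hpay : payF z = (queryOf e w).tail := by rw [payF, Function.comp_apply, hq]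
  have hmem : memT z = [decide ((queryOf e w).tail ∈ tbl)] := by
    rw [memT, Function.comp_apply, fanoutFn_apply, htbl, hpay, anyFn_boolPair oneBit_eqPairFn', decNil_encList]
    simp only [List.cons.injEq, and_true, decide_eq_decide, eqPairFn_boolPair, decide_eq_true_eq]
    exact ⟨fun ⟨p, hp, h⟩ => by rw [h]; exact hp, fun h => ⟨_, h, rfl⟩⟩
  -- the side, the flip, the admissibility
  have hside : sideT z = [oside (queryOf e w)] := by
    rcases hqw : queryOf e w with _ | ⟨b, p⟩
    · rw [sideT, iteFn_apply_true (by rw [hnil, hqw]; rfl)]; rfl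
    · rw [sideT, iteFn_apply_false (by rw [hnil, hqw]; rfl), Function.comp_apply, hq, hqw]; rfl
  have hflip : flipT z = [oflip tbl a (queryOf e w)] := by
    rcases hqw : queryOf e w with _ | ⟨_ | _, p⟩
    · rw [flipT, iteFn_apply_true (by rw [hside, hqw]; rfl), iteFn_apply_true (by rw [hnil, hqw]; rfl)]; rfl
    · rw [flipT, iteFn_apply_false (by rw [hside, hqw]; rfl), haT]; rfl
    · rw [flipT, iteFn_apply_true (by rw [hside, hqw]; rfl), iteFn_apply_false (by rw [hnil, hqw]; rfl), hmem, hqw]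
      rfl
  have hok : okT z = [!c && (!a || !oside (queryOf e w))] := by
    rw [okT, andFn_apply (notFn_apply hcT) (orFn_apply (notFn_apply haT) (notFn_apply hside))]
  have hnew : newBitT z = [w (e (Fin.last k)) ^^ oflip tbl a (queryOf e w)] := by
    rw [newBitT, xorT_apply hans hflip]
  have hlabNew : labNewF z = List.ofFn (flipAt e w (oflip tbl a (queryOf e w))) := by
    have hset := set_label w (e (Fin.last k)) (w (e (Fin.last k)) ^^ oflip tbl a (queryOf e w))
    rw [labNewF]
    simp only [Function.comp_apply, fanoutFn_apply, hpos, hlab, takeFn_boolPair, hnew, dropFn_boolPair,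
      OracleCompose.concatFn_boolPair, List.length_cons, length_ones]
    rw [← List.append_assoc, hset]
    rfl
  have h1 : (eqPairFn ∘ fanoutFn labNewF lab'F) z =
      [decide (List.ofFn (flipAt e w (oflip tbl a (queryOf e w))) = List.ofFn w')] := by
    rw [Function.comp_apply, fanoutFn_apply, eqPairFn_boolPair, hlabNew, hz, lab'F_chkArg]
  have h2 : (eqPairFn ∘ fanoutFn phbF ph'F) z = [decide (ph = ph')] := by
    rw [Function.comp_apply, fanoutFn_apply, eqPairFn_boolPair, hz, phbF_chkArg, ph'F_chkArg]
  rw [oracleChkT, andFn_apply hok (andFn_apply h1 h2)]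

/-- The raw value is the trusting oracle step. [folklore] -/
theorem oStep_raw (q : List Bool) (f : Bool) :
    oStep tbl c a q = some f ↔ (!c && (!a || !oside q)) = true ∧ oflip tbl a q = f := by
  rcases q with _ | ⟨_ | _, p⟩ <;> cases c <;> cases a <;> simp [oStep, oside, oflip]

/-- **Value of the oracle check against the trusting step** (phases `< 8` as 3-bit numerals).
[cite: AaronsonChen2017, §5.3 (p. 22)] -/
theorem oracleChkT_chkArg_eq {φ φ' : ℕ} (hφ : φ < 8) (hφ' : φ' < 8) :
    oracleChkT (chkArg (acGateCode (QGate.oracle k e) tbl) c a (List.ofFn w) (bits3 φ) (List.ofFn w') (bits3 φ')) =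
      [decide (stepOut (QGate.oracle k e) tbl c a w φ = some (w', φ'))] := by
  rw [oracleChkT_chkArg]
  congr 1
  rw [Bool.eq_iff_iff]
  have hph : bits3 φ = bits3 φ' ↔ (φ + 0) % 8 = φ' := by
    rw [Nat.add_zero, Nat.mod_eq_of_lt hφ]
    exact ⟨fun h => bits3_injective hφ hφ' h, fun h => by rw [h]⟩
  simp only [Bool.and_eq_true, decide_eq_true_eq, List.ofFn_inj, hph, stepOut, trustStep]
  rcases hst : oStep tbl c a (queryOf e w) with _ | f
  · simp only [Option.map_none, reduceCtorEq, iff_false, not_and]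
    intro hok _ _
    have hok' : (!c && (!a || !oside (queryOf e w))) = true := by simpa [Bool.and_eq_true] using hok
    have := (oStep_raw tbl c a (queryOf e w) (oflip tbl a (queryOf e w))).2 ⟨hok', rfl⟩
    rw [hst] at this
    exact absurd this (by simp)
  · obtain ⟨hok, hf⟩ := (oStep_raw tbl c a (queryOf e w) f).1 hst
    have hok' : (!c) = true ∧ (!a || !oside (queryOf e w)) = true := by simpa [Bool.and_eq_true] using hok
    simp only [Option.map_some, Option.some.injEq, Prod.mk.injEq, hok', true_and, hf]

end OracleValue

/-! ### Value of the check -/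

/-- **The one-gate check is the trusting step**: on the argument record of an annotated gate `g`
(table `tbl`), bits `c a`, label `w` and phase `φ < 8` before, claimed label `w'` and phase
`φ' < 8` after, `stepChkT` returns `[stepOut g tbl c a w φ = some (w', φ')]` — the claimed item
is the trusting step of the previous one, phases added modulo `8`.
[cite: AaronsonChen2017, §5.3 (pp. 22–23)] [cite: AdlemanDeMarraisHuang1997, §6 Lemma 6.10 (proof, step 3)] -/
theorem stepChkT_chkArg (g : QGate cliffordT N) (tbl : List (List Bool)) (c a : Bool) (w w' : QReg N) {φ φ' : ℕ}
    (hφ : φ < 8) (hφ' : φ' < 8) :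
    stepChkT (chkArg (acGateCode g tbl) c a (List.ofFn w) (bits3 φ) (List.ofFn w') (bits3 φ')) =
      [decide (stepOut g tbl c a w φ = some (w', φ'))] := by
  cases g with
  | gate op e =>
    have htag : (take1Fn ∘ gcF) (chkArg (acGateCode (QGate.gate op e) tbl) c a (List.ofFn w) (bits3 φ)
        (List.ofFn w') (bits3 φ')) = [false] := by
      rw [Function.comp_apply, gcF_chkArg]
      cases op <;> rfl
    rw [stepChkT, iteFn_apply_false htag, cliffChkT_chkArg op e tbl c a w w' hφ hφ']
  | oracle k e =>
    have htag : (take1Fn ∘ gcF) (chkArg (acGateCode (QGate.oracle k e) tbl) c a (List.ofFn w) (bits3 φ)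
        (List.ofFn w') (bits3 φ')) = [true] := by
      rw [Function.comp_apply, gcF_chkArg]; rfl
    rw [stepChkT, iteFn_apply_true htag, oracleChkT_chkArg_eq e tbl c a w w' hφ hφ']

/-- `stepChkT` is one bit on well-formed arguments; in general its first symbol is what the
tableau check reads. Correct guesses make `stepOut` the annotated path step:
`stepOut g tbl c (guessOf B g w) w φ = (annPathStep (g, B ⊕ ↑tbl) c w).map (·, (φ + ·) mod 8)`.
[cite: AaronsonChen2017, §5.3 (p. 22)] -/
theorem stepOut_guessOf (B : Language Bool) (g : QGate cliffordT N) (tbl : List (List Bool)) (c : Bool)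
    (w : QReg N) (φ : ℕ) :
    stepOut g tbl c (guessOf B g w) w φ =
      (annPathStep (g, oracleJoin B {p | p ∈ tbl}) c w).map fun r => (r.1, (φ + r.2) % 8) := by
  rw [stepOut, trustStep_eq_annPathStep]

end AcTab

end Literature.Barriers.QuantumAdvantage

end
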